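import Summits.HodgeConjecture.HodgeConjecture.Theorems.Ring2HypothesesDescentMotivatedTotalOperators
import Summits.HodgeConjecture.HodgeConjecture.Theorems.EndoscopicMiddleDegreeAlgebraicOrEnvelopedStubCorrActionAdjoint
import Summits.HodgeConjecture.HodgeConjecture.Theorems.Ring2HypothesesDescentMotivatedCorrespondences
import Summits.HodgeConjecture.HodgeConjecture.Theorems.Ring2AbelianAllAndreNumericalLift
import HarnessLib

/-!
# Ring 2 hypotheses, descent face — THE TRANSPOSE OF A CORRESPONDENCE CLASS: the swap push-forward `σ₊ u` acts as
# the cup-adjoint of `u` in every degree; transfer of «acts as 0» and «acts as the identity» to the dual degree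

research route conditional on HC_CM; not a corollary; Q11.4-sentence-2 already refuted in dim ≥ 3.
Cell `pub-hodge-ring2` (Hodge ladder STAGE 3), seat `ring2-b05` (binder row b05
`Ring2.Hypotheses.MotivatedImpliesAlgebraicAV`), gen 36. `HC_CM` (`Theses.RankFourFaces.CMAbelianHodge`) does
not occur in this file; nothing here proves a case of the Hodge conjecture; the row b05 stays OPEN.

Kleiman 1968 §1.4 (1.4.4): the Künneth projector of complementary degree is the TRANSPOSE, `π^{2n-i} = ᵗπ^i`. On the
real carriers the transpose of `u ∈ H^{2e}((X ⊗ X)(ℂ))` is the swap push-forward `σ₊ u`, `σ = β_ X X`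
(route `CoreSplittingLadder`'s `cupProduct_corrAction_eq` proved `P_u x ∪ y = x ∪ P_{σ₊u} y` in the MIDDLE degree);
this file proves the identity in ALL degrees and draws the two transfers used by Kleiman's induction:

* §1 `cupProduct_corrAction_braiding` — for `x ∈ Hᵃ`, `y ∈ H^q`, `[u]_* : Hᵃ → Hᵇ` (`a + 2e = b + 2n`, `b + q = 2n`):
  `[u]_* x ∪ y = (-1)^{bq + qa} • x ∪ [σ₊ u]_* y` in `H²ⁿ(X(ℂ))` (projection formula three times, `pr₁₊ σ₊ = pr₂₊`,
  and `pr₁₊ = pr₂₊` on the top degree, `complexGysin_apply_eq_of_top`).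
* §2 `corrAction_braiding_eq_zero` — if `[u]_*` vanishes on `Hᵃ` then `[σ₊ u]_*` vanishes on `H^{2n-b}`;
  `corrAction_braiding_eq_smul_id` — if `[u]_* = id` on `Hᵃ` (`e = n`) then `[σ₊ u]_* = ± id` on `H^{2n-a}`
  (non-degeneracy of the cup pairing of the closed manifold `X(ℂ)`, ab-andre-2's `eq_zero_of_forall_cupProduct_eq_zero'`).
* §3 `complexGysin_braiding_mem_motivatedClasses` — `σ₊` preserves motivated classes (Gysin maps do, gen 34), as it
  preserves algebraic ones (`CoreSplittingLadder.complexGysin_braiding_mem_algebraicClasses`).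

No definition, no named fact, no sorry. References: Kleiman1968AlgebraicCycles (§1.4 Prop. 1.4.4), FultonYoungTableaux1997
(App. B (5)–(6)), VoisinHodgeII2003 (proof of Thm. 10.17 (10.7)), HatcherAT2002 (§3.3 Prop. 3.38).
-/

noncomputable section

-- every declaration of this problem lives in `Summit.HodgeConjecture.HodgeConjecture.…` (summit = sub-problem)
set_option linter.dupNamespace false

open CategoryTheory AlgebraicGeometry MonoidalCategory CartesianMonoidalCategory
open Literature.AlgebraicTopology.SingularHomology Literature.Geometry.Kaehler
open Literature.AlgebraicGeometry Literature.AlgebraicGeometry.Motives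
  Literature.AlgebraicGeometry.HodgeTheory

namespace Summit.HodgeConjecture.HodgeConjecture.Theorems

variable (μ : OrientationFamily) {n : ℕ} {X : SchemeOver ℂ}

/-! ## §1 `[u]_* x ∪ y = ± x ∪ [σ₊ u]_* y` in every degree -/

/-- **The swap push-forward acts as the cup-adjoint, all degrees.** `X` smooth projective of dimension `n`,
`u ∈ H^{2e}((X ⊗ X)(ℂ))`, `x ∈ Hᵃ(X(ℂ))`, `y ∈ H^q(X(ℂ))`, `a + 2e = b + 2n`, `b + q = 2n`, `q + 2e = q' + 2n`
(so `a + q' = 2n`): `[u]_* x ∪ y = (-1)^{bq + qa} • (x ∪ [σ₊ u]_* y)` in `H²ⁿ(X(ℂ); ℂ)`, `σ₊ u = complexGysin μ _ _ (β_ X X).hom _ u`.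
Both sides are `pr₁₊(pr₂^* x ∪ (pr₁^* y ∪ u))` up to the sign: projection formula for `pr₁`, for `σ` and for `pr₁` again,
`pr₁₊ ∘ σ₊ = (σ ≫ pr₁)₊ = pr₂₊` (`complexGysin_comp`), and `pr₁₊ = pr₂₊` on the top degree of `(X ⊗ X)(ℂ)`
(`CoreSplittingLadder.complexGysin_apply_eq_of_top`). [cite: Kleiman1968AlgebraicCycles, §1.4 Prop. 1.4.4]
[cite: FultonYoungTableaux1997, Appendix B §B.1 (5)–(6)] [cite: VoisinHodgeII2003, proof of Thm. 10.17 (10.7)] -/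
theorem cupProduct_corrAction_braiding (hX : IsSmoothProjective n X) {e a b q q' : ℕ} (hab : a + 2 * e = b + 2 * n)
    (hk : b + q = 2 * n) (hq' : q + 2 * e = q' + 2 * n) (hk' : a + q' = 2 * n) (u : complexBetti (X ⊗ X) (2 * e))
    (x : complexBetti X a) (y : complexBetti X q) :
    cupProduct hk (corrAction μ hX hX hab u x) y =
      ((-1 : ℂ) ^ (b * q + q * a)) • cupProduct hk' x (corrAction μ hX hX hq'
        (complexGysin μ (IsSmoothProjective.tensor_holds hX hX) (IsSmoothProjective.tensor_holds hX hX) (β_ X X).hom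
          (rfl : 2 * e + 2 * (n + n) = 2 * e + 2 * (n + n)) u) y) := by
  have hμ : μ.HasPoincareDuality := OrientationFamily.hasPoincareDuality μ
  have hT : IsSmoothProjective (n + n) (X ⊗ X) := IsSmoothProjective.tensor_holds hX hX
  -- degree bookkeeping: the big class `pr₂^* x ∪ (pr₁^* y ∪ u)` has the top degree `N = 2(n+n)`
  have hN : a + (q + 2 * e) = 2 * (n + n) := by omega
  have hN' : q + (a + 2 * e) = 2 * (n + n) := by omega
  have htop : 2 * (n + n) + 2 * n = 2 * n + 2 * (n + n) := by omega
  -- `σ^* pr₂^* = pr₁^*`, `σ^* pr₁^* = pr₂^*`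
  have e1 : complexBetti.map (β_ X X).hom q (complexBetti.map (snd X X) q y) = complexBetti.map (fst X X) q y := by
    rw [← CategoryTheory.comp_apply, ← complexBetti.map_comp, braiding_hom_snd]
  have e2 : complexBetti.map (β_ X X).hom a (complexBetti.map (fst X X) a x) = complexBetti.map (snd X X) a x := by
    rw [← CategoryTheory.comp_apply, ← complexBetti.map_comp, braiding_hom_fst]
  -- the left-hand side: `(-1)^{bq} (-1)^{qa} pr₁₊(pr₂^* x ∪ (pr₁^* y ∪ u))`
  have hL : cupProduct hk (corrAction μ hX hX hab u x) y =
      ((-1 : ℂ) ^ (b * q + q * a)) • complexGysin μ hT hX (fst X X) htop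
        (cupProduct hN (complexBetti.map (snd X X) a x)
          (cupProduct rfl (complexBetti.map (fst X X) q y) u)) := by
    rw [cupProduct_gradedComm_holds ℂ _ hk (show q + b = 2 * n by omega) (corrAction μ hX hX hab u x) y,
      corrAction_apply,
      ← complexGysin_cup hμ hT hX (fst X X) hN' htop (corrAction_degree n hab) (show q + b = 2 * n by omega) y,
      ← cupProduct_assoc (rfl : q + a = q + a) (rfl : a + 2 * e = a + 2 * e) (show q + a + 2 * e = 2 * (n + n) by omega)
        hN' (complexBetti.map (fst X X) q y) (complexBetti.map (snd X X) a x) u,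
      cupProduct_gradedComm_holds ℂ _ (rfl : q + a = q + a) (show a + q = q + a by omega)
        (complexBetti.map (fst X X) q y) (complexBetti.map (snd X X) a x),
      map_smul, LinearMap.smul_apply, map_smul, smul_smul, ← pow_add,
      cupProduct_assoc (show a + q = q + a by omega) (rfl : q + 2 * e = q + 2 * e)
        (show q + a + 2 * e = 2 * (n + n) by omega) hN (complexBetti.map (snd X X) a x)
        (complexBetti.map (fst X X) q y) u]
  -- the right-hand side: `pr₂₊(pr₂^* x ∪ (pr₁^* y ∪ u))`
  have hR : cupProduct hk' x (corrAction μ hX hX hq'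
        (complexGysin μ hT hT (β_ X X).hom (rfl : 2 * e + 2 * (n + n) = 2 * e + 2 * (n + n)) u) y) =
      complexGysin μ hT hX (snd X X) htop
        (cupProduct hN (complexBetti.map (snd X X) a x)
          (cupProduct rfl (complexBetti.map (fst X X) q y) u)) := by
    -- `pr₂^* y ∪ σ₊ u = σ₊(pr₁^* y ∪ u)`
    have e3 : cupProduct (rfl : q + 2 * e = q + 2 * e) (complexBetti.map (snd X X) q y)
          (complexGysin μ hT hT (β_ X X).hom (rfl : 2 * e + 2 * (n + n) = 2 * e + 2 * (n + n)) u) =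
        complexGysin μ hT hT (β_ X X).hom (rfl : q + 2 * e + 2 * (n + n) = q + 2 * e + 2 * (n + n))
          (cupProduct rfl (complexBetti.map (fst X X) q y) u) := by
      rw [← complexGysin_cup hμ hT hT (β_ X X).hom rfl rfl rfl rfl (complexBetti.map (snd X X) q y) u, e1]
    -- `pr₁^* x ∪ σ₊ w = σ₊(pr₂^* x ∪ w)`
    have e4 : cupProduct hN (complexBetti.map (fst X X) a x)
          (complexGysin μ hT hT (β_ X X).hom (rfl : q + 2 * e + 2 * (n + n) = q + 2 * e + 2 * (n + n))
            (cupProduct rfl (complexBetti.map (fst X X) q y) u)) =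
        complexGysin μ hT hT (β_ X X).hom (rfl : 2 * (n + n) + 2 * (n + n) = 2 * (n + n) + 2 * (n + n))
          (cupProduct hN (complexBetti.map (snd X X) a x) (cupProduct rfl (complexBetti.map (fst X X) q y) u)) := by
      rw [← complexGysin_cup hμ hT hT (β_ X X).hom hN rfl rfl hN (complexBetti.map (fst X X) a x) _, e2]
    -- `pr₁₊ ∘ σ₊ = pr₂₊`
    have e5 : ∀ z, complexGysin μ hT hX (fst X X) htop (complexGysin μ hT hT (β_ X X).hom
        (rfl : 2 * (n + n) + 2 * (n + n) = 2 * (n + n) + 2 * (n + n)) z) =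
        complexGysin μ hT hX (snd X X) htop z := by
      intro z
      have hc := LinearMap.congr_fun (complexGysin_comp hμ hT hT hX (β_ X X).hom (fst X X) rfl htop) z
      rw [LinearMap.comp_apply] at hc
      rw [← hc]
      simp only [braiding_hom_fst]
    rw [corrAction_apply, e3, ← complexGysin_cup hμ hT hX (fst X X) hN htop
      (show q + 2 * e + 2 * n = q' + 2 * (n + n) by omega) hk' x, e4, e5]
  rw [hL, hR, CoreSplittingLadder.complexGysin_apply_eq_of_top μ hμ hT hX (fst X X) (snd X X) htop rfl]

/-! ## §2 Transfer of «acts as zero» and «acts as the identity» to the dual degree -/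

/-- **If `[u]_*` vanishes on `Hᵃ` then `[σ₊ u]_*` vanishes on `H^q`, `q = 2n - b`** (`[u]_* : Hᵃ → Hᵇ`).
[cite: Kleiman1968AlgebraicCycles, §1.4 Prop. 1.4.4] -/
theorem corrAction_braiding_eq_zero (hX : IsSmoothProjective n X) {e a b q q' : ℕ} (hab : a + 2 * e = b + 2 * n)
    (hk : b + q = 2 * n) (hq' : q + 2 * e = q' + 2 * n) (u : complexBetti (X ⊗ X) (2 * e))
    (hu : corrAction μ hX hX hab u = 0) :
    corrAction μ hX hX hq' (complexGysin μ (IsSmoothProjective.tensor_holds hX hX)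
      (IsSmoothProjective.tensor_holds hX hX) (β_ X X).hom (rfl : 2 * e + 2 * (n + n) = 2 * e + 2 * (n + n)) u) = 0 := by
  have hk' : a + q' = 2 * n := by omega
  refine LinearMap.ext fun y ↦ ?_
  rw [LinearMap.zero_apply]
  refine Ring2.AbelianAll.eq_zero_of_forall_cupProduct_eq_zero' hX hk' fun x ↦ ?_
  have h := cupProduct_corrAction_braiding μ hX hab hk hq' hk' u x y
  rw [hu, LinearMap.zero_apply, map_zero, LinearMap.zero_apply] at h
  exact ((smul_eq_zero_iff_right (pow_ne_zero _ (neg_ne_zero.mpr one_ne_zero))).1 h.symm)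

/-- **If `[u]_* = id` on `Hᵃ` (`u` of codimension `n`) then `[σ₊ u]_* = (-1)^{aq+qa} • id = id`-up-to-sign on
`H^q`, `q = 2n - a`.** [cite: Kleiman1968AlgebraicCycles, §1.4 Prop. 1.4.4] -/
theorem corrAction_braiding_eq_smul_id (hX : IsSmoothProjective n X) {a q : ℕ} (hk : a + q = 2 * n)
    (u : complexBetti (X ⊗ X) (2 * n)) (hu : corrAction μ hX hX (rfl : a + 2 * n = a + 2 * n) u = LinearMap.id) :
    corrAction μ hX hX (rfl : q + 2 * n = q + 2 * n) (complexGysin μ (IsSmoothProjective.tensor_holds hX hX)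
      (IsSmoothProjective.tensor_holds hX hX) (β_ X X).hom (rfl : 2 * n + 2 * (n + n) = 2 * n + 2 * (n + n)) u) =
      ((-1 : ℂ) ^ (a * q + q * a)) • LinearMap.id := by
  refine LinearMap.ext fun y ↦ ?_
  rw [LinearMap.smul_apply, LinearMap.id_apply, ← sub_eq_zero]
  refine Ring2.AbelianAll.eq_zero_of_forall_cupProduct_eq_zero' hX hk fun x ↦ ?_
  have h := cupProduct_corrAction_braiding μ hX (rfl : a + 2 * n = a + 2 * n) hk rfl hk u x y
  rw [hu, LinearMap.id_apply] at h
  rw [map_sub, map_smul, h, smul_smul, ← pow_add, Even.neg_one_pow ⟨a * q + q * a, rfl⟩, one_smul, sub_self]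

/-! ## §3 The swap push-forward preserves motivated classes -/

/-- **`σ₊` preserves motivated classes** (every Gysin map between smooth projective varieties does, gen 34's
`Ring2.Hypotheses.complexGysin_mem_motivatedClasses`). [cite: Andre1996Motifs, Prop. 2.1 (ii) (p. 14)] -/
theorem complexGysin_braiding_mem_motivatedClasses (hX : IsSmoothProjective n X) {e : ℕ}
    {u : complexBetti (X ⊗ X) (2 * e)} (hu : u ∈ motivatedClasses (n + n) (X ⊗ X) e) :
    complexGysin μ (IsSmoothProjective.tensor_holds hX hX) (IsSmoothProjective.tensor_holds hX hX) (β_ X X).hom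
      (rfl : 2 * e + 2 * (n + n) = 2 * e + 2 * (n + n)) u ∈ motivatedClasses (n + n) (X ⊗ X) e := by
  by_cases he : e ≤ n + n
  · exact Ring2.Hypotheses.complexGysin_mem_motivatedClasses μ (IsSmoothProjective.tensor_holds hX hX)
      (IsSmoothProjective.tensor_holds hX hX) (β_ X X).hom rfl he hu
  · rw [motivatedClasses_eq_bot_of_lt (n := n + n) (X := X ⊗ X) (show n + n < e by omega)] at hu ⊢
    rw [(Submodule.mem_bot ℂ).1 hu, map_zero]
    exact Submodule.zero_mem _

end Summit.HodgeConjecture.HodgeConjecture.Theorems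

end
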